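import Mathlib
import HarnessLib
import Summits.AtomisticToContinuum.FouriersLaw.Theses.HoelderEscapeProfile

/-!
# Line `coboundary` — DIRICHLET PRINCIPLE FOR THE RETURN PROBABILITY: the local energy is an
approximate Liouville coboundary (crux `HoelderEscapeProfile.LocalEnergyHalfHoelder`,
item `stmt-AtomisticToContinuum-16008`, route `route-AtomisticToContinuum-HoelderEscapeProfile`, rank 2;
strategist `planner-cstrat-stmt-AtomisticToContinuum-16008-b1-0`, 2026-08-17; ALTERNATIVE to `Lines/birth.lean`)

Crux (FIXED, concluded BY NAME below): for the guarded infinite pinned chain `(μ, D)` at temperature `T`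
and the split-bond site energy `h`, `Ψ(ν) := ν∫₀^∞ e^{-νt} Cov_μ(h_0, h_0∘φ_t) dt ≤ C√ν` for `0 < ν ≤ ν₀`.

## The lever (one identity, one construction)

Let `U_t u = u ∘ φ_t` be the Koopman ISOMETRY group of the `μ`-preserving flow on `L²(μ)` and `𝒜` the
Liouville operator of the chain (`liouvilleZ`, in tree), which IS the time derivative along orbits of every
`C¹` cylinder function (chain rule + `IsSolution`).  COMPLETING THE SQUARE for a skew generator gives the
one-sided **Dirichlet (H₋₁-type) bound for the Abel return functional**

  (★)  `Ψ(ν) ≤ 2‖h̃_0 + 𝒜f‖²_{L²(μ)} + 2ν²‖f‖²_{L²(μ)}`  for EVERY `C¹` cylinder `f` with `f, 𝒜f ∈ L²(μ)`,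

(`h̃_0 = h_0 − ⟨h_0⟩`; proof: `Ψ(ν) = ν²‖A‖²` for `A = ∫e^{-νt}U_t h̃_0`, and the pathwise antiderivative
relation `f∘φ_t − f = ∫₀ᵗ (𝒜f)∘φ_s ds` gives `A = ∫e^{-νt}U_t(h̃_0+𝒜f) + f − ν∫e^{-νt}U_t f`, whence
`‖νA‖ ≤ ‖h̃_0 + 𝒜f‖ + ν‖f‖` by Minkowski and `‖f − ν∫e^{-νt}U_tf‖² = ‖f‖² − ν²‖∫e^{-νt}U_tf‖² ≤ ‖f‖²`).
It is Bernardin–Olla's resolvent variational formula `⟨g,(λ−𝒜)⁻¹g⟩ = inf_f {λ⁻¹‖g+𝒜f‖² + λ‖f‖²}`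
(arXiv:1105.0493 §6, eq. (var) at `γ = 0`; Sethuraman) read as an INEQUALITY in the even (energy) sector,
with equality at the resolvent `f* = 𝒜(ν²−𝒜²)⁻¹h̃_0` (so nothing is lost).  Consequently

  `LocalEnergyHalfHoelder ⟸ (★) + a STATIC TRIAL FAMILY`: `C¹` cylinder functions `f_ν` with
  `2‖h̃_0 + 𝒜f_ν‖²_μ + 2ν²‖f_ν‖²_μ ≤ C√ν` for `0 < ν ≤ ν₀`.

The load-bearing stub `stub_staticTrialFamily` DOES NOT MENTION THE DYNAMICS `D`: both norms are Gibbs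
expectations of explicit functions (`𝒜f` is computed symbolically), so the ½-Hölder RETURN RATE becomes a
CONSTRUCTION (approximate antiderivatives of the local energy along the Liouville vector field, "the local
energy is cheaply a coboundary") controlled by EQUILIBRIUM statistical mechanics of the 1-D Gibbs state
(transfer operator, cluster / low-temperature Gaussian expansions).  Budget bookkeeping (diffusive
calibration): `‖f_ν‖² ≍ ν^{-3/2}`, `‖h̃_0 + 𝒜f_ν‖² ≍ √ν`; the optimal `f*` is `−½∫ sign(t)e^{-ν|t|} U_t h̃_0 dt`;
its hydrodynamic skeleton is `f_ν ≈ Σ_x a_ν(x) h̃_x − Σ_x ∇a_ν(x) g_{ν,x}` with `(ν − DΔ)a_ν = δ_0`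
(lattice Yukawa kernel, range `√(D/ν)`) and `g_ν` the `ν`-regularised antiderivative of the FAST CURRENT
`j + D∇h̃` (fluctuation–dissipation corrector), for which `h̃_0 + 𝒜f_ν = ν Σ_x a_ν(x)h̃_x + Σ_x ∇a_ν(x) w_{ν,x}`,
`w_ν = j + D∇h̃ − 𝒜g_ν`.  Any explicit family gives a RIGOROUS one-sided bound; e.g. the harmonic resolvent as
trial function yields `Ψ(ν) ≤ C√ν` in the kinetic window `ν ≥ ν_*(lam, β, T)` by purely static estimates
(a landable `--supports` lemma, not the crux).

* `stub_abelDirichletBound` — (★) under the crux's hypotheses VERBATIM (size L; provable now: Koopman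
  isometries from `PreservesMeasure`, chain rule along `IsSolution` orbits for cylinder `f` via
  `liouvilleZ_comp_boxRestrict`, Carathéodory joint measurability, Fubini for the Laplace transform,
  Minkowski/Cauchy–Schwarz in `L²(μ)`; no spectral theorem, no Stone).
* `stub_staticTrialFamily` — the STATIC existence statement above (size: open problem = the content of K1
  in coboundary language; fails iff K1 fails or cylinder functions are not a core for the Liouvillian —
  essential skew-adjointness à la Marchioro–Pellegrinotti–Pulvirenti 1978, the flagged risk).
* `LocalEnergyHalfHoelder_of : stub₁-statement → stub₂-statement → LocalEnergyHalfHoelder` — sorry-free.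

Disproof used: none on file for this crux (no `Disproof.lean`, no `Negative/` lemma, 2026-08-17).
-/

noncomputable section

open MeasureTheory

namespace Summit.AtomisticToContinuum.FouriersLaw.Cruxes.LocalEnergyHalfHoelder

namespace Coboundary

/-! ## The two declared stub STATEMENTS (`Stmt.stub_…`, matched BY NAME to the sorried stubs below) -/

/-- Statement of stub 1 (`stub_abelDirichletBound`): the DIRICHLET / H₋₁ UPPER BOUND for the Abel return functional.
Under the hypotheses of `HoelderEscapeProfile.LocalEnergyHalfHoelder` VERBATIM: for every `C¹` cylinder trial function
`f = g ∘ boxRestrict R` with `f, 𝒜f ∈ L²(μ)` (`𝒜 = liouvilleZ` of the pinned chain) and every `ν > 0`,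
`ν∫₀^∞e^{-νt}S(0,t)dt ≤ 2∫(h̃_0 + 𝒜f)² dμ + 2ν²∫f² dμ`.  Completing the square for the skew generator of the Koopman
isometry group; equality (with constants 1) at the resolvent.  Size L, provable now. -/
abbrev Stmt.stub_abelDirichletBound : Prop :=
    ∀ ω₂ lam β γ : ℝ, 0 < ω₂ → 0 < lam → 0 < β → ∀ T : ℝ, 0 < T → ∀ μ : MeasureTheory.Measure Literature.MathematicalPhysics.KineticTheory.HeatConduction.ChainConfig, (Literature.MathematicalPhysics.KineticTheory.HeatConduction.pinnedChain ω₂ lam β γ).IsChainGibbsMeasure T μ → Literature.MathematicalPhysics.KineticTheory.HeatConduction.IsShiftInvariant μ → μ.map (fun σ : Literature.MathematicalPhysics.KineticTheory.HeatConduction.ChainConfig => fun x : ℤ => ((σ x).1, -(σ x).2)) = μ → ∀ D : Literature.MathematicalPhysics.KineticTheory.HeatConduction.InfiniteChainDynamics (Literature.MathematicalPhysics.KineticTheory.HeatConduction.pinnedChain ω₂ lam β γ), D.PreservesMeasure μ → (∀ t : ℝ, ∀ᵐ σ ∂μ, D.flow t (Literature.MathematicalPhysics.KineticTheory.HeatConduction.shift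 σ) = Literature.MathematicalPhysics.KineticTheory.HeatConduction.shift (D.flow t σ)) → ∀ h : Literature.MathematicalPhysics.KineticTheory.HeatConduction.ChainConfig → ℤ → ℝ, h = (fun (σ : Literature.MathematicalPhysics.KineticTheory.HeatConduction.ChainConfig) (x : ℤ) => (σ x).2 ^ 2 / 2 + (Literature.MathematicalPhysics.KineticTheory.HeatConduction.pinnedChain ω₂ lam β γ).U (σ x).1 + ((Literature.MathematicalPhysics.KineticTheory.HeatConduction.pinnedChain ω₂ lam β γ).V ((σ (x + 1)).1 - (σ x).1) + (Literature.MathematicalPhysics.KineticTheory.HeatConduction.pinnedChain ω₂ lam β γ).V ((σ x).1 - (σ (x - 1)).1)) / 2) → ∀ S : ℤ → ℝ → ℝ, S = (fun (x : ℤ) (t : ℝ) => ∫ σ, (h σ 0 - ∫ σ', h σ' 0 ∂μ) * (h (D.flow t σ) x - ∫ σ', h σ' 0 ∂μ) ∂μ) → (∀ ν : ℝ, 0 < ν → MeasureTheory.IntegrableOn (fun t : ℝ => Real.exp (-(ν * t)) * S 0 t) (Set.Ioi 0)) →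
    ∀ f : Literature.MathematicalPhysics.KineticTheory.HeatConduction.ChainConfig → ℝ, (∃ (R : ℕ) (g : (Fin (2 * R + 1) → ℝ × ℝ) → ℝ), ContDiff ℝ 1 g ∧ f = g ∘ Literature.MathematicalPhysics.KineticTheory.HeatConduction.boxRestrict R) → MeasureTheory.MemLp f 2 μ → MeasureTheory.MemLp (Literature.MathematicalPhysics.KineticTheory.HeatConduction.liouvilleZ (Literature.MathematicalPhysics.KineticTheory.HeatConduction.pinnedChain ω₂ lam β γ) f) 2 μ → ∀ ν : ℝ, 0 < ν → ν * ∫ t in Set.Ioi (0:ℝ), Real.exp (-(ν * t)) * S 0 t ≤ 2 * ∫ σ, (h σ 0 - (∫ σ', h σ' 0 ∂μ) + Literature.MathematicalPhysics.KineticTheory.HeatConduction.liouvilleZ (Literature.MathematicalPhysics.KineticTheory.HeatConduction.pinnedChain ω₂ lam β γ) f σ) ^ 2 ∂μ + 2 * ν ^ 2 * ∫ σ, (f σ) ^ 2 ∂μ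

/-- Statement of stub 2 (`stub_staticTrialFamily`): THE LOCAL ENERGY IS CHEAPLY AN APPROXIMATE COBOUNDARY — STATIC, no
dynamics.  For the pinned chain (`ω₂, lam, β > 0`, any `γ`), `T > 0` and every shift- and momentum-reversal-invariant Gibbs
state `μ` at `T`: there are `C, ν₀ > 0` such that for every `0 < ν ≤ ν₀` some `C¹` cylinder function `f_ν` with
`f_ν, 𝒜f_ν ∈ L²(μ)` has `2∫(h̃_0 + 𝒜f_ν)² dμ + 2ν²∫f_ν² dμ ≤ C√ν` (defect `O(ν^{1/4})`, norm `O(ν^{-3/4})`: the diffusive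
budget).  Open problem (= K1 in coboundary language). -/
abbrev Stmt.stub_staticTrialFamily : Prop :=
    ∀ ω₂ lam β γ : ℝ, 0 < ω₂ → 0 < lam → 0 < β → ∀ T : ℝ, 0 < T → ∀ μ : MeasureTheory.Measure Literature.MathematicalPhysics.KineticTheory.HeatConduction.ChainConfig, (Literature.MathematicalPhysics.KineticTheory.HeatConduction.pinnedChain ω₂ lam β γ).IsChainGibbsMeasure T μ → Literature.MathematicalPhysics.KineticTheory.HeatConduction.IsShiftInvariant μ → μ.map (fun σ : Literature.MathematicalPhysics.KineticTheory.HeatConduction.ChainConfig => fun x : ℤ => ((σ x).1, -(σ x).2)) = μ → ∀ h : Literature.MathematicalPhysics.KineticTheory.HeatConduction.ChainConfig → ℤ → ℝ, h = (fun (σ : Literature.MathematicalPhysics.KineticTheory.HeatConduction.ChainConfig) (x : ℤ) => (σ x).2 ^ 2 / 2 + (Literature.MathematicalPhysics.KineticTheory.HeatConduction.pinnedChain ω₂ lam β γ).U (σ x).1 + ((Literature.MathematicalPhysics.KineticTheory.HeatConduction.pinnedChain ω₂ lam β γ).V ((σ (x + 1)).1 - (σ x).1) + (Literature.MathematicalPhysics.KineticTheory.HeatConduction.pinnedChain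 ω₂ lam β γ).V ((σ x).1 - (σ (x - 1)).1)) / 2) →
    ∃ C ν₀ : ℝ, 0 < ν₀ ∧ ∀ ν : ℝ, 0 < ν → ν ≤ ν₀ → ∃ f : Literature.MathematicalPhysics.KineticTheory.HeatConduction.ChainConfig → ℝ, (∃ (R : ℕ) (g : (Fin (2 * R + 1) → ℝ × ℝ) → ℝ), ContDiff ℝ 1 g ∧ f = g ∘ Literature.MathematicalPhysics.KineticTheory.HeatConduction.boxRestrict R) ∧ MeasureTheory.MemLp f 2 μ ∧ MeasureTheory.MemLp (Literature.MathematicalPhysics.KineticTheory.HeatConduction.liouvilleZ (Literature.MathematicalPhysics.KineticTheory.HeatConduction.pinnedChain ω₂ lam β γ) f) 2 μ ∧ 2 * ∫ σ, (h σ 0 - (∫ σ', h σ' 0 ∂μ) + Literature.MathematicalPhysics.KineticTheory.HeatConduction.liouvilleZ (Literature.MathematicalPhysics.KineticTheory.HeatConduction.pinnedChain ω₂ lam β γ) f σ) ^ 2 ∂μ + 2 * ν ^ 2 * ∫ σ, (f σ) ^ 2 ∂μ ≤ C * Real.sqrt ν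

/-! ## The two registered stubs -/

/-- **stub 1 — `stub_abelDirichletBound`** (statement `Stmt.stub_abelDirichletBound`). -/
theorem stub_abelDirichletBound : Stmt.stub_abelDirichletBound := by
  sorry

/-- **stub 2 — `stub_staticTrialFamily`** (statement `Stmt.stub_staticTrialFamily`; the load-bearing, dynamics-free stub). -/
theorem stub_staticTrialFamily : Stmt.stub_staticTrialFamily := by
  sorry

/-! ## The composition (sorry-free) -/

/-- **Skeleton theorem — the crux `HoelderEscapeProfile.LocalEnergyHalfHoelder` BY NAME from the two declared stubs**:
`Stmt.stub_abelDirichletBound → Stmt.stub_staticTrialFamily → LocalEnergyHalfHoelder` (the stub STATEMENTS, by name), sorry-free and closed (axioms `propext`,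
`Classical.choice`, `Quot.sound` at most): for `0 < ν ≤ ν₀` take the trial function `f_ν` of stub 2 and feed it to the
Dirichlet bound of stub 1. -/
theorem LocalEnergyHalfHoelder_of :
    Stmt.stub_abelDirichletBound → Stmt.stub_staticTrialFamily → _root_.Summit.AtomisticToContinuum.FouriersLaw.Theses.HoelderEscapeProfile.LocalEnergyHalfHoelder := by
  intro hDir hTrial ω₂ lam β γ hω hl hβ T hT μ hG hSI hRefl D hP hShift h hh S hS hInt
  obtain ⟨C, ν₀, hν₀, hfam⟩ := hTrial ω₂ lam β γ hω hl hβ T hT μ hG hSI hRefl h hh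
  refine ⟨C, ν₀, hν₀, fun ν hν hle => ?_⟩
  obtain ⟨f, hcyl, hf2, hAf2, hbound⟩ := hfam ν hν hle
  exact (hDir ω₂ lam β γ hω hl hβ T hT μ hG hSI hRefl D hP hShift h hh S hS hInt f hcyl hf2 hAf2 ν hν).trans hbound

/-- The stubs plug into `LocalEnergyHalfHoelder_of` (type check of the cut; this declaration inherits the two stub
`sorry`s and contains none of its own). -/
theorem LocalEnergyHalfHoelder_skeleton :
    _root_.Summit.AtomisticToContinuum.FouriersLaw.Theses.HoelderEscapeProfile.LocalEnergyHalfHoelder :=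
  LocalEnergyHalfHoelder_of stub_abelDirichletBound stub_staticTrialFamily

end Coboundary

end Summit.AtomisticToContinuum.FouriersLaw.Cruxes.LocalEnergyHalfHoelder

end
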